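import Summits.KontsevichZagierPeriods.KontsevichZagierPeriods.Theorems.SoloInformedParamCombo
import Summits.KontsevichZagierPeriods.KontsevichZagierPeriods.Theorems.SoloInformedParamRealise
import Summits.KontsevichZagierPeriods.KontsevichZagierPeriods.Theorems.SoloInformedParamAdmDef
import HarnessLib

/-!
# Generator definability I: the integrand-additivity move (1b)

Every bounded integrand-additivity move of `KZ_ℝ` satisfies the definability invariant:
`soloInformed_definableRel_of_mem_bddIntegrandAddRel :
  ∀ c ∈ soloInformedBddIntegrandAddRel ℝ, SoloInformedDefinableRel c`.
This discharges one of the four hypotheses of the kernel THEOREM R / THEOREM T for bounded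
chains (`soloInformed_realParameterBarrier_bdd`, `soloInformed_realParameterTransfer_bdd`).

Construction: realise `r, r₁, r₂` as admissible parametrised terms (`soloInformed_exists_pterm_rep`),
join the parameter spaces, take the three-term combination `[T] − [U₁] − [U₂]`, and let the good
set `V` be cut out by admissibility, equality of fibres and the graph-additivity clause — all
`ℚ`-semialgebraic (`SoloInformedParamAdmDef`); on `V` the combination is a bounded (1b) move over
`ℝ`, and at parameters with rational fibres its `ℚ`-forms are a bounded (1b) move over `ℚ`.

References: [cite: KontsevichZagier2001, §1.2 rule (1)]; [cite: BochnakCosteRoy1998, Prop. 2.2.4].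
-/

noncomputable section

open Set MeasureTheory MvPolynomial Literature.ModelTheory.ExponentialFields
  Literature.NumberTheory.Transcendental

namespace Summit.KontsevichZagierPeriods.KontsevichZagierPeriods.Theorems

namespace SoloInformedPTerm

variable {K : Type} {d : ℕ} {T : SoloInformedPTerm K d} {p : K → ℝ}

/-- At an admissible parameter the graph fibre over the fibre is the graph of the integrand of
the denoted representation. [cite: KontsevichZagier2001, §1.1] -/
theorem snoc_mem_gfibre_iff_of_adm (h : T.SoloInformedAdm p) {x : Fin d → ℝ}
    (hx : x ∈ T.fibre p) (t : ℝ) : Fin.snoc x t ∈ T.gfibre p ↔ t = (T.rep p).integrand x := by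
  rw [rep_integrand h, hybrid_of_mem hx]
  exact ⟨fun ht => (gval_eq h.1 hx ht).symm, fun ht => ht ▸ snoc_gval_mem h.1 hx⟩

/-- A real representation is its own base change to `ℝ`. [cite: KontsevichZagier2001, §1.1] -/
theorem _root_.Summit.KontsevichZagierPeriods.KontsevichZagierPeriods.Theorems.soloInformed_baseChange_real
    {n : ℕ} (A : KZOver.IntegralRep ℝ n) : A.baseChange ℝ = A :=
  KZOver.IntegralRep.ext rfl rfl

end SoloInformedPTerm

namespace SoloInformedPCombo

variable {K : Type} {n : ℕ}

/-- The three-term combination `[T] − [U₁] − [U₂]` of terms of one dimension.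
[cite: KontsevichZagier2001, §1.2] -/
def three (T U₁ U₂ : SoloInformedPTerm K n) : SoloInformedPCombo K where
  ι := Fin 3
  hι := inferInstance
  dim := fun _ => n
  term := fun t => (![T, U₁, U₂] : Fin 3 → SoloInformedPTerm K n) t
  coef := ![1, -1, -1]

/-- The element denoted by the three-term combination. [cite: KontsevichZagier2001, §1.2] -/
theorem combo_three (T U₁ U₂ : SoloInformedPTerm K n) (p : K → ℝ) :
    (three T U₁ U₂).combo p =
      KZOver.of (T.rep p) - KZOver.of (U₁.rep p) - KZOver.of (U₂.rep p) := by
  show ∑ t : Fin 3, (three T U₁ U₂).coef t • KZOver.of (((three T U₁ U₂).term t).rep p) = _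
  rw [Fin.sum_univ_three]
  simp only [three, Matrix.cons_val_zero, Matrix.cons_val_one, Matrix.head_cons,
    Matrix.cons_val_two, Matrix.tail_cons, one_zsmul, neg_zsmul, sub_eq_add_neg]

/-- Admissibility of the three-term combination. [cite: KontsevichZagier2001, §1.1] -/
theorem adm_three {T U₁ U₂ : SoloInformedPTerm K n} {p : K → ℝ} (hT : T.SoloInformedAdm p)
    (h₁ : U₁.SoloInformedAdm p) (h₂ : U₂.SoloInformedAdm p) : (three T U₁ U₂).SoloInformedAdm p := by
  intro t
  show ((![T, U₁, U₂] : Fin 3 → SoloInformedPTerm K n) t).SoloInformedAdm p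
  fin_cases t
  · exact hT
  · exact h₁
  · exact h₂

/-- A rational lift of the three-term combination from rational forms of its terms.
[cite: KontsevichZagier2001, §1.2] -/
theorem ratLift_three {T U₁ U₂ : SoloInformedPTerm K n} {p : K → ℝ}
    (q₀ q₁ q₂ : KZOver.IntegralRep ℚ n) (h₀ : q₀.baseChange ℝ = T.rep p)
    (h₁ : q₁.baseChange ℝ = U₁.rep p) (h₂ : q₂.baseChange ℝ = U₂.rep p)
    (hrel : KZOver.of q₀ - KZOver.of q₁ - KZOver.of q₂ ∈ soloInformedRelationsBdd ℚ) :
    (three T U₁ U₂).SoloInformedRatLift p := by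
  refine ⟨fun t => (![q₀, q₁, q₂] : Fin 3 → KZOver.IntegralRep ℚ n) t, fun t => ?_, ?_⟩
  · show KZOver.IntegralRep.baseChange ℝ ((![q₀, q₁, q₂] : Fin 3 → KZOver.IntegralRep ℚ n) t) =
      ((![T, U₁, U₂] : Fin 3 → SoloInformedPTerm K n) t).rep p
    fin_cases t
    · exact h₀
    · exact h₁
    · exact h₂
  · show ∑ t : Fin 3, (three T U₁ U₂).coef t •
      KZOver.of ((![q₀, q₁, q₂] : Fin 3 → KZOver.IntegralRep ℚ n) t) ∈ _
    rw [Fin.sum_univ_three]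
    simpa only [three, Matrix.cons_val_zero, Matrix.cons_val_one, Matrix.head_cons,
      Matrix.cons_val_two, Matrix.tail_cons, one_zsmul, neg_zsmul, sub_eq_add_neg] using hrel

end SoloInformedPCombo

/-- The bounded (1b) move over `k` from its side conditions read on base changes to `ℝ`.
[cite: KontsevichZagier2001, §1.2 rule (1)] -/
theorem soloInformed_mem_bddIntegrandAddRel_of_baseChange {k : Type*} [CommRing k] [Algebra k ℝ]
    {n : ℕ} {x y z : KZOver.IntegralRep k n} {A A₁ A₂ : KZOver.IntegralRep ℝ n}
    (hx : x.baseChange ℝ = A) (hy : y.baseChange ℝ = A₁) (hz : z.baseChange ℝ = A₂)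
    (hA : SoloInformedBddRep A) (hA₁ : SoloInformedBddRep A₁) (hA₂ : SoloInformedBddRep A₂)
    (hd₁ : A₁.domain = A.domain) (hd₂ : A₂.domain = A.domain)
    (hadd : EqOn A.integrand (A₁.integrand + A₂.integrand) A.domain) :
    KZOver.of x - KZOver.of y - KZOver.of z ∈ soloInformedBddIntegrandAddRel k := by
  subst hx hy hz
  exact ⟨n, x, y, z, hA, hA₁, hA₂, hd₁, hd₂, hadd, rfl⟩

/-- **Definability of the bounded integrand-additivity move (1b).**
[cite: KontsevichZagier2001, §1.2 rule (1)] -/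
theorem soloInformed_definableRel_of_mem_bddIntegrandAddRel {c : KZOver.FormalRep ℝ}
    (hc : c ∈ soloInformedBddIntegrandAddRel ℝ) : SoloInformedDefinableRel c := by
  classical
  obtain ⟨n, r, r₁, r₂, hr, hr₁, hr₂, hd₁, hd₂, hadd, rfl⟩ := hc
  obtain ⟨K₀, _, T₀, p₀, hA₀, hrep₀, -⟩ := soloInformed_exists_pterm_rep r hr
  obtain ⟨K₁, _, T₁, p₁, hA₁, hrep₁, -⟩ := soloInformed_exists_pterm_rep r₁ hr₁
  obtain ⟨K₂, _, T₂, p₂, hA₂, hrep₂, -⟩ := soloInformed_exists_pterm_rep r₂ hr₂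
  -- common parameter space
  let θ₀ : K₀ → (K₀ ⊕ K₁) ⊕ K₂ := fun i => Sum.inl (Sum.inl i)
  let θ₁ : K₁ → (K₀ ⊕ K₁) ⊕ K₂ := fun i => Sum.inl (Sum.inr i)
  let θ₂ : K₂ → (K₀ ⊕ K₁) ⊕ K₂ := Sum.inr
  let T := T₀.pullback θ₀
  let U₁ := T₁.pullback θ₁
  let U₂ := T₂.pullback θ₂
  let q : (K₀ ⊕ K₁) ⊕ K₂ → ℝ := Sum.elim (Sum.elim p₀ p₁) p₂
  have hq₀ : q ∘ θ₀ = p₀ := rfl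
  have hq₁ : q ∘ θ₁ = p₁ := rfl
  have hq₂ : q ∘ θ₂ = p₂ := Sum.elim_comp_inr _ _
  have hTrep : ∀ p, T.rep p = T₀.rep (p ∘ θ₀) := fun p => SoloInformedPTerm.rep_pullback _ _ _
  have hU₁rep : ∀ p, U₁.rep p = T₁.rep (p ∘ θ₁) := fun p => SoloInformedPTerm.rep_pullback _ _ _
  have hU₂rep : ∀ p, U₂.rep p = T₂.rep (p ∘ θ₂) := fun p => SoloInformedPTerm.rep_pullback _ _ _
  have hTadm : ∀ p, T.SoloInformedAdm p ↔ T₀.SoloInformedAdm (p ∘ θ₀) := fun p =>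
    SoloInformedPTerm.adm_pullback_iff _ _ _
  have hU₁adm : ∀ p, U₁.SoloInformedAdm p ↔ T₁.SoloInformedAdm (p ∘ θ₁) := fun p =>
    SoloInformedPTerm.adm_pullback_iff _ _ _
  have hU₂adm : ∀ p, U₂.SoloInformedAdm p ↔ T₂.SoloInformedAdm (p ∘ θ₂) := fun p =>
    SoloInformedPTerm.adm_pullback_iff _ _ _
  -- the good set
  let V : Set ((K₀ ⊕ K₁) ⊕ K₂ → ℝ) := {p | T.SoloInformedAdm p ∧ U₁.SoloInformedAdm p ∧
    U₂.SoloInformedAdm p ∧ U₁.fibre p = T.fibre p ∧ U₂.fibre p = T.fibre p ∧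
    SoloInformedPTerm.SoloInformedAddClause T U₁ U₂ p}
  have hV : IsSemialgebraic ℚ V :=
    soloInformed_isSemialgebraic_setOf_and T.isSemialgebraic_setOf_adm
      (soloInformed_isSemialgebraic_setOf_and U₁.isSemialgebraic_setOf_adm
      (soloInformed_isSemialgebraic_setOf_and U₂.isSemialgebraic_setOf_adm
      (soloInformed_isSemialgebraic_setOf_and (SoloInformedPTerm.isSemialgebraic_setOf_fibre_eq _ _)
      (soloInformed_isSemialgebraic_setOf_and (SoloInformedPTerm.isSemialgebraic_setOf_fibre_eq _ _)
      (SoloInformedPTerm.isSemialgebraic_setOf_addClause _ _ _)))))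
  -- side conditions on `V`
  have hside : ∀ p ∈ V, (T.rep p).domain = (U₁.rep p).domain ∧
      (T.rep p).domain = (U₂.rep p).domain ∧
      EqOn (T.rep p).integrand ((U₁.rep p).integrand + (U₂.rep p).integrand) (T.rep p).domain := by
    rintro p ⟨hT, h₁, h₂, hf₁, hf₂, hcl⟩
    rw [SoloInformedPTerm.rep_domain hT, SoloInformedPTerm.rep_domain h₁,
      SoloInformedPTerm.rep_domain h₂, hf₁, hf₂]
    refine ⟨rfl, rfl, fun x hx => ?_⟩
    rw [Pi.add_apply, SoloInformedPTerm.rep_integrand hT, SoloInformedPTerm.rep_integrand h₁,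
      SoloInformedPTerm.rep_integrand h₂, SoloInformedPTerm.hybrid_of_mem hx,
      SoloInformedPTerm.hybrid_of_mem (hf₁.symm ▸ hx : x ∈ U₁.fibre p),
      SoloInformedPTerm.hybrid_of_mem (hf₂.symm ▸ hx : x ∈ U₂.fibre p)]
    exact SoloInformedPTerm.gval_eq_add_of_addClause hcl hT.1 h₁.1 h₂.1 hx (hf₁.symm ▸ hx)
      (hf₂.symm ▸ hx)
  refine ⟨(K₀ ⊕ K₁) ⊕ K₂, inferInstance, SoloInformedPCombo.three T U₁ U₂, q, V, hV, ?_, ?_, ?_, ?_⟩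
  · -- the original parameter is good
    have hT : T.SoloInformedAdm q := (hTadm q).2 (hq₀ ▸ hA₀)
    have h₁ : U₁.SoloInformedAdm q := (hU₁adm q).2 (hq₁ ▸ hA₁)
    have h₂ : U₂.SoloInformedAdm q := (hU₂adm q).2 (hq₂ ▸ hA₂)
    have hTq : T.rep q = r := by rw [hTrep, hq₀, hrep₀]
    have h₁q : U₁.rep q = r₁ := by rw [hU₁rep, hq₁, hrep₁]
    have h₂q : U₂.rep q = r₂ := by rw [hU₂rep, hq₂, hrep₂]
    have hfT : T.fibre q = r.domain := by rw [← SoloInformedPTerm.rep_domain hT, hTq]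
    have hf₁ : U₁.fibre q = r.domain := by rw [← SoloInformedPTerm.rep_domain h₁, h₁q, hd₁]
    have hf₂ : U₂.fibre q = r.domain := by rw [← SoloInformedPTerm.rep_domain h₂, h₂q, hd₂]
    refine ⟨hT, h₁, h₂, hf₁.trans hfT.symm, hf₂.trans hfT.symm, ?_⟩
    refine SoloInformedPTerm.addClause_of_graphs (g := r.integrand) (g₁ := r₁.integrand)
      (g₂ := r₂.integrand) (fun x hx t => ?_) (fun x hx t => ?_) (fun x hx t => ?_)
      (fun x hx => hadd (hfT ▸ hx))
    · rw [SoloInformedPTerm.snoc_mem_gfibre_iff_of_adm hT hx, hTq]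
    · rw [SoloInformedPTerm.snoc_mem_gfibre_iff_of_adm h₁ (hf₁.symm ▸ hfT ▸ hx), h₁q]
    · rw [SoloInformedPTerm.snoc_mem_gfibre_iff_of_adm h₂ (hf₂.symm ▸ hfT ▸ hx), h₂q]
  · -- it denotes `c`
    rw [SoloInformedPCombo.combo_three, hTrep, hU₁rep, hU₂rep, hq₀, hq₁, hq₂, hrep₀, hrep₁, hrep₂]
  · -- every good parameter denotes a bounded (1b) move over `ℝ`
    rintro p hp
    obtain ⟨hd₁', hd₂', hadd'⟩ := hside p hp
    obtain ⟨hT, h₁, h₂, -, -, -⟩ := hp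
    refine ⟨SoloInformedPCombo.adm_three hT h₁ h₂, ?_⟩
    rw [SoloInformedPCombo.combo_three]
    exact soloInformed_mem_relationsBdd_of_mem_generators (Or.inl (Or.inl (Or.inr
      (soloInformed_mem_bddIntegrandAddRel_of_baseChange (soloInformed_baseChange_real _)
        (soloInformed_baseChange_real _) (soloInformed_baseChange_real _)
        (SoloInformedPTerm.bddRep_rep hT) (SoloInformedPTerm.bddRep_rep h₁)
        (SoloInformedPTerm.bddRep_rep h₂) hd₁'.symm hd₂'.symm hadd'))))
  · -- rational lift at parameters with rational fibres
    rintro p hp hRF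
    obtain ⟨hd₁', hd₂', hadd'⟩ := hside p hp
    obtain ⟨hT, h₁, h₂, -, -, -⟩ := hp
    obtain ⟨hS₀, hG₀⟩ := soloInformedRatFibres.fibre hRF T
    obtain ⟨hS₁, hG₁⟩ := soloInformedRatFibres.fibre hRF U₁
    obtain ⟨hS₂, hG₂⟩ := soloInformedRatFibres.fibre hRF U₂
    refine SoloInformedPCombo.ratLift_three (SoloInformedPTerm.ratRep hS₀ hG₀ hT)
      (SoloInformedPTerm.ratRep hS₁ hG₁ h₁) (SoloInformedPTerm.ratRep hS₂ hG₂ h₂)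
      (SoloInformedPTerm.baseChange_ratRep _ _ _) (SoloInformedPTerm.baseChange_ratRep _ _ _)
      (SoloInformedPTerm.baseChange_ratRep _ _ _) ?_
    exact soloInformed_mem_relationsBdd_of_mem_generators (Or.inl (Or.inl (Or.inr
      (soloInformed_mem_bddIntegrandAddRel_of_baseChange
        (SoloInformedPTerm.baseChange_ratRep _ _ _) (SoloInformedPTerm.baseChange_ratRep _ _ _)
        (SoloInformedPTerm.baseChange_ratRep _ _ _)
        (SoloInformedPTerm.bddRep_rep hT) (SoloInformedPTerm.bddRep_rep h₁)
        (SoloInformedPTerm.bddRep_rep h₂) hd₁'.symm hd₂'.symm hadd'))))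

/-- **The (1b) hypothesis of THEOREM R / T, discharged.** [cite: KontsevichZagier2001, §1.2] -/
theorem soloInformed_definableRel_bddIntegrandAddRel :
    ∀ c ∈ soloInformedBddIntegrandAddRel ℝ, SoloInformedDefinableRel c :=
  fun _ hc => soloInformed_definableRel_of_mem_bddIntegrandAddRel hc

end Summit.KontsevichZagierPeriods.KontsevichZagierPeriods.Theorems
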